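import Summits.AtomisticToContinuum.Crystallization.Theses.ThreeConeCertificate
import Literature.Barriers.AtomisticToContinuum.IcosahedralClusters
import Literature.MathematicalPhysics.StatisticalMechanics.HardCoreGSC

/-!
# `OnePercentCertificate` (stmt-AtomisticToContinuum-11958) / Negative: the certificate mechanism,
what the crux implies, and which hypotheses a refutation must use

Negative knowledge for the crux of route `ThreeConeCertificate` (crux-disprover seat, 2026-08-16;
work file `Cruxes/OnePercentCertificate/Disproof.lean`).  Nothing here closes an item.

* `onePercentCertificate_value_lower_bound` — for EVERY admissible three-cone split
  (`V_LJ = g + U + f` on `(0,∞)`, `U ≥ 0`, `f` of positive type, `g` `c`-stable) and every injective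
  configuration, `-(c + f 0 / 2)·N ≤ E_LJ(x)`.  The range condition `g ≡ 0` on `[5/2,∞)` is NOT used.
* hence `OnePercentCertificate → ∀ x injective, -(29/40)·N ≤ E_LJ(x)` (`…_stability_bound`): the crux
  contains the Lennard-Jones stability bound `B_LJ ≤ 8.7 ε` (printed window `8.61 ≤ B_LJ ≤ 14.316 ε`,
  Yuhjtman 2015, Thm 9), and the crux WITHOUT its range condition is EQUIVALENT to that bound
  (`onePercentCertificate_withoutRange_iff`).  So a refutation of the crux must either produce a finite
  configuration with `E_LJ(x) < -(29/40)·N` (`not_onePercentCertificate_of_config`; numerically none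
  exists, `E(N)/N > e(hcp) ≈ -0.7176`) or exploit the range `5/2` (a non-realizable "phantom" pair
  measure, the LP dual).
* `onePercentCertificate_value_gt_ico` — every admissible split has value `> 3677/13000 ≈ 0.2829`
  (the icosahedral `13`-cluster of `IcosahedralClusters`): the natural strengthening of the crux with the
  constant `29/40` replaced by `3677/13000` is false at every range (`not_threeConeCertificate_ico`).
-/

noncomputable section

namespace Summit.AtomisticToContinuum.Crystallization.Theorems

open scoped BigOperators
open Literature.MathematicalPhysics.StatisticalMechanics
open Summit.AtomisticToContinuum.Crystallization.Theses.ThreeConeCertificate (OnePercentCertificate)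

section Mechanism

variable {c : ℝ} {g U f : ℝ → ℝ}

/-- Termwise splitting of the energy along `V_LJ = g + U + f` on `(0,∞)`: all pair distances of an
injective configuration are positive. [folklore] -/
theorem interactionEnergy_lennardJones_split
    (hdec : ∀ r : ℝ, 0 < r → lennardJones r = g r + U r + f r)
    {N : ℕ} {x : Fin N → EuclideanSpace ℝ (Fin 3)} (hx : Function.Injective x) :
    interactionEnergy lennardJones x =
      interactionEnergy g x + interactionEnergy U x + interactionEnergy f x := by
  unfold interactionEnergy
  rw [← Finset.sum_add_distrib, ← Finset.sum_add_distrib]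
  refine Finset.sum_congr rfl fun i _ => ?_
  rw [← Finset.sum_add_distrib, ← Finset.sum_add_distrib]
  refine Finset.sum_congr rfl fun j hj => ?_
  exact hdec _ (dist_pos.2 (hx.ne (ne_of_lt (Finset.mem_Ioi.1 hj))))

/-- A termwise nonnegative potential (on `(0,∞)`) has nonnegative energy on injective
configurations. [folklore] -/
theorem interactionEnergy_nonneg_of_forall_pos_nonneg (hU : ∀ r : ℝ, 0 < r → 0 ≤ U r)
    {N : ℕ} {x : Fin N → EuclideanSpace ℝ (Fin 3)} (hx : Function.Injective x) :
    0 ≤ interactionEnergy U x := by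
  unfold interactionEnergy
  exact Finset.sum_nonneg fun i _ => Finset.sum_nonneg fun j hj =>
    hU _ (dist_pos.2 (hx.ne (ne_of_lt (Finset.mem_Ioi.1 hj))))

/-- The Bochner cone tested with all weights `1` at the configuration itself:
`N f(0) + 2 Σ_{i<j} f(r_ij) ≥ 0`. [cite: Ruelle1969, §3.2 Prop. 3.2.7] -/
theorem neg_card_mul_le_interactionEnergy_of_posType
    (hpos : ∀ (n : ℕ) (y : Fin n → EuclideanSpace ℝ (Fin 3)) (w : Fin n → ℝ),
      0 ≤ ∑ i, ∑ j, w i * w j * f (dist (y i) (y j)))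
    {N : ℕ} (x : Fin N → EuclideanSpace ℝ (Fin 3)) :
    -((N : ℝ) * f 0 / 2) ≤ interactionEnergy f x := by
  have h := hpos N x (fun _ => 1)
  simp only [one_mul] at h
  have h2 := two_mul_interactionEnergy_eq_sum_sum_sub f x
  linarith

/-- **Value lower bound of a three-cone split.** For every admissible split (decomposition on
`(0,∞)`, `U ≥ 0`, `f` of positive type, `g` `c`-stable) and every injective configuration,
`-(c + f(0)/2)·N ≤ E_LJ(x)`; the range condition of the crux is not used.
[cite: Ruelle1969, §3.2 Prop. 3.2.7] -/
theorem onePercentCertificate_value_lower_bound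
    (hdec : ∀ r : ℝ, 0 < r → lennardJones r = g r + U r + f r)
    (hU : ∀ r : ℝ, 0 < r → 0 ≤ U r)
    (hpos : ∀ (n : ℕ) (y : Fin n → EuclideanSpace ℝ (Fin 3)) (w : Fin n → ℝ),
      0 ≤ ∑ i, ∑ j, w i * w j * f (dist (y i) (y j)))
    (hstab : ∀ (N : ℕ) (x : Fin N → EuclideanSpace ℝ (Fin 3)), Function.Injective x →
      -(c * (N : ℝ)) ≤ interactionEnergy g x)
    {N : ℕ} {x : Fin N → EuclideanSpace ℝ (Fin 3)} (hx : Function.Injective x) :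
    -((c + f 0 / 2) * (N : ℝ)) ≤ interactionEnergy lennardJones x := by
  rw [interactionEnergy_lennardJones_split hdec hx]
  have h1 := hstab N x hx
  have h2 := interactionEnergy_nonneg_of_forall_pos_nonneg hU hx
  have h3 := neg_card_mul_le_interactionEnergy_of_posType hpos x
  linarith

/-- Every admissible three-cone split (of any range) has value `> 3677/13000 ≈ 0.2829`: test the
icosahedral `13`-cluster of `IcosahedralClusters` (energy `< -3.677`).
[cite: KlemanLavrentovich2003, §2.1.3 (pp. 54–55)] -/
theorem onePercentCertificate_value_gt_ico
    (hdec : ∀ r : ℝ, 0 < r → lennardJones r = g r + U r + f r)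
    (hU : ∀ r : ℝ, 0 < r → 0 ≤ U r)
    (hpos : ∀ (n : ℕ) (y : Fin n → EuclideanSpace ℝ (Fin 3)) (w : Fin n → ℝ),
      0 ≤ ∑ i, ∑ j, w i * w j * f (dist (y i) (y j)))
    (hstab : ∀ (N : ℕ) (x : Fin N → EuclideanSpace ℝ (Fin 3)), Function.Injective x →
      -(c * (N : ℝ)) ≤ interactionEnergy g x) :
    (3677 / 13000 : ℝ) < c + f 0 / 2 := by
  have h := onePercentCertificate_value_lower_bound hdec hU hpos hstab
    Literature.Barriers.AtomisticToContinuum.icosahedralCluster_injective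
  have hE := Literature.Barriers.AtomisticToContinuum.interactionEnergy_icosahedralCluster_lt
  simp only [Nat.cast_ofNat] at h
  linarith

end Mechanism

/-- **The crux contains the stability bound `B_LJ ≤ 29/40`:** `OnePercentCertificate` implies
`E_LJ(x) ≥ -(29/40)·N` for every finite configuration of distinct points (`8.7 ε`; printed
`8.61 ≤ B_LJ ≤ 14.316 ε`). [cite: Yuhjtman2015, Thm. 9] -/
theorem onePercentCertificate_stability_bound (h : OnePercentCertificate) :
    ∀ (N : ℕ) (x : Fin N → EuclideanSpace ℝ (Fin 3)), Function.Injective x →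
      -((29 / 40 : ℝ) * N) ≤ interactionEnergy lennardJones x := by
  obtain ⟨c, g, U, f, hdec, hU, _hrange, hpos, hstab, hval⟩ := h
  intro N x hx
  have h1 := onePercentCertificate_value_lower_bound hdec hU hpos hstab hx
  have h2 := mul_le_mul_of_nonneg_right hval (Nat.cast_nonneg N)
  linarith

/-- Refutation criterion by one low-energy configuration (contrapositive): an injective `x` with
`E_LJ(x) < -(29/40)·N` kills the crux. Numerically none exists (`E(N)/N > e(hcp) ≈ -0.7176`), so a
refutation must use the range `5/2`. [folklore] -/
theorem not_onePercentCertificate_of_config {N : ℕ} {x : Fin N → EuclideanSpace ℝ (Fin 3)}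
    (hx : Function.Injective x)
    (hE : interactionEnergy lennardJones x < -((29 / 40 : ℝ) * N)) : ¬ OnePercentCertificate :=
  fun h => (onePercentCertificate_stability_bound h N x hx).not_gt hE

/-- **Without its range condition the crux is EXACTLY the stability bound `B_LJ ≤ 29/40`** (open,
believed true with `B_LJ = -e(hcp) ≈ 0.7176`). Hence the range `g ≡ 0` on `[5/2,∞)` is the only
hypothesis a refutation can exploit. [cite: Yuhjtman2015, Thm. 9] -/
theorem onePercentCertificate_withoutRange_iff :
    (∃ (c : ℝ) (g U f : ℝ → ℝ), (∀ r : ℝ, 0 < r → lennardJones r = g r + U r + f r) ∧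
      (∀ r : ℝ, 0 < r → 0 ≤ U r) ∧
      (∀ (n : ℕ) (y : Fin n → EuclideanSpace ℝ (Fin 3)) (w : Fin n → ℝ),
        0 ≤ ∑ i, ∑ j, w i * w j * f (dist (y i) (y j))) ∧
      (∀ (N : ℕ) (x : Fin N → EuclideanSpace ℝ (Fin 3)), Function.Injective x →
        -(c * (N : ℝ)) ≤ interactionEnergy g x) ∧
      c + f 0 / 2 ≤ 29 / 40) ↔
    ∀ (N : ℕ) (x : Fin N → EuclideanSpace ℝ (Fin 3)), Function.Injective x →
      -((29 / 40 : ℝ) * N) ≤ interactionEnergy lennardJones x := by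
  constructor
  · rintro ⟨c, g, U, f, hdec, hU, hpos, hstab, hval⟩ N x hx
    have h1 := onePercentCertificate_value_lower_bound hdec hU hpos hstab hx
    have h2 := mul_le_mul_of_nonneg_right hval (Nat.cast_nonneg N)
    linarith
  · intro h
    exact ⟨29 / 40, lennardJones, fun _ => 0, fun _ => 0, fun r _ => by ring, fun _ _ => le_rfl,
      fun n y w => by simp, fun N x hx => h N x hx, by norm_num⟩

/-- The crux implies its range-free form (i.e. the stability bound). [folklore] -/
theorem onePercentCertificate_withoutRange (h : OnePercentCertificate) :
    ∃ (c : ℝ) (g U f : ℝ → ℝ), (∀ r : ℝ, 0 < r → lennardJones r = g r + U r + f r) ∧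
      (∀ r : ℝ, 0 < r → 0 ≤ U r) ∧
      (∀ (n : ℕ) (y : Fin n → EuclideanSpace ℝ (Fin 3)) (w : Fin n → ℝ),
        0 ≤ ∑ i, ∑ j, w i * w j * f (dist (y i) (y j))) ∧
      (∀ (N : ℕ) (x : Fin N → EuclideanSpace ℝ (Fin 3)), Function.Injective x →
        -(c * (N : ℝ)) ≤ interactionEnergy g x) ∧
      c + f 0 / 2 ≤ 29 / 40 :=
  onePercentCertificate_withoutRange_iff.2 (onePercentCertificate_stability_bound h)

/-- **Strengthening refuted:** the crux with `29/40` replaced by `3677/13000` (same shape, any use of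
the range allowed) is false. [cite: KlemanLavrentovich2003, §2.1.3 (pp. 54–55)] -/
theorem not_threeConeCertificate_ico :
    ¬ ∃ (c : ℝ) (g U f : ℝ → ℝ), (∀ r : ℝ, 0 < r → lennardJones r = g r + U r + f r) ∧
      (∀ r : ℝ, 0 < r → 0 ≤ U r) ∧ (∀ r : ℝ, 5 / 2 ≤ r → g r = 0) ∧
      (∀ (n : ℕ) (y : Fin n → EuclideanSpace ℝ (Fin 3)) (w : Fin n → ℝ),
        0 ≤ ∑ i, ∑ j, w i * w j * f (dist (y i) (y j))) ∧
      (∀ (N : ℕ) (x : Fin N → EuclideanSpace ℝ (Fin 3)), Function.Injective x →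
        -(c * (N : ℝ)) ≤ interactionEnergy g x) ∧
      c + f 0 / 2 ≤ 3677 / 13000 :=
  fun ⟨_, _, _, _, hdec, hU, _, hpos, hstab, hval⟩ =>
    (onePercentCertificate_value_gt_ico hdec hU hpos hstab).not_ge hval

end Summit.AtomisticToContinuum.Crystallization.Theorems
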